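import Mathlib
import Summits.ResolutionOfSingularities.ResolutionOfSingularities.Theorems.RadicialJungCleanModelsCleanLU3ArcDischarge
import Summits.ResolutionOfSingularities.ResolutionOfSingularities.Theorems.RadicialJungCleanModelsCleanLU3ArcTower
import Literature.AlgebraicGeometry.Resolution.TranscendenceDefect
import HarnessLib

/-!
# res-B-lens-5 g7 (lens 5): THEOREM P — the potential argument for class (A) over EVERY residue tower and ground field (PROVED)

Crux of record: stmt-ResolutionOfSingularities-0549 `Theses.Descent.DescentPerfectToAll` (FIXED, not restated; this file is
15917-side support = where rung-B content starts: imperfect ground field, non-rational arc).  SORRY-FREE.  What is proved here: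

* `arcPotential` / `arcPotentialAt_holds (hp : p.Prime) : ArcPotentialAt p` — **THEOREM P** of memo
  `CLASSA-allfields-potential-lens5.md` (e709ae1b8c5f) §2 = the typed target `ArcPotentialAt p` of `Census_lens5_arcPotential.lean`
  (46f6cec37822) = the landed ✓ `cleanLU3Defect_of_discrete_of_finiteResidue` WITHOUT its finite-residue-tower hypothesis: along a
  DISCRETE RANK-ONE `O` dominating a 3-dimensional regular centre of a f.g. `k`-algebra `A` (any field `k` of char `p`), for `g₀` with
  no best `p`-th-power approximation and a derivation `D` of `K` with `D g₀ ≠ 0`, `s • D(A) ⊆ A`, some quadratic transform `A'` along `O`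
  puts `b^p g₀ − c^p` in loose clean form (1) monomial `π^r F` times unit with `p ∤ r`, `(π, F, t₃)` a r.s.p., or (2) a unit that is
  not a `p`-th power mod `𝔪`, or (3) an order-one element.
* `cleanLU3DefectArcInfinite_of_absDerivation (hD : ∀ p, p.Prime → AbsDerivationMovesAt p) : <the lead's stub_cleanLU3DefectArcInfinite,
  CleanModels Lines/Sketch.lean rev 20, VERBATIM>` — `hD` is ✓ `absDerivationMovesAt_holds` of the sibling workfile
  `Lens5_AbsDerivation.lean` (d237cf907357, sorry-free); Cruxes modules are not importable on the farm, so the composition is left to the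
  landing under `Theorems/` (3 lines).  With d237cf907357 (`stub_cleanLU3DefectArcConstants`) and 5d37f7a70d6b
  (`stub_derivation_of_not_mem_adjoin_pow`) this closes ALL THREE class-(A) arc stubs of rev 20, over every ground field.

Proof architecture (all ring-level, no coefficient fields, no residue-field hypothesis): package ✓ `exists_quadraticSeq_package`, climb
until `π ∈ R n₁` (✓ `exists_mem_of_quadraticTransforms_of_discrete`), transport `s • D` along the `π`-charts (`derivation_transport_pow`),
peel `s₁ D h = π^o u` (✓ `exists_eq_pow_mul_unit`), restart at `n₁ + o`; then the potential induction `CoreHyp.core` on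
`μ = 3 (e₀ + N − a) + bonus (m − a)` over states `(N, c, a, m)` with `c ∈ R N`, `(h − c^p)/π^a ∈ R N`, `v(h − c^p) = v(π)^m`:
(P0) `p ∣ m` (`valuation_sub_pow_eq_pow_mul` + defect), (P1) Jacobian bound `a ≤ e₀ + N`, update `c += π^{a/p} β` / exit (2) when
`m = a`, one blow-up when `m = a + 1`, division by `π²` when the cofactor is in `𝔪²`, and the valuative detector (P2)
(`indep_of_valuation` + `exists_span_triple_of_indep`) giving exit (1)/(3) otherwise.
bears_on: LADDER-RESOLUTION:B · [OURS · CANDIDATE] counted 0; nothing here proves resolution in characteristic `p`.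
-/

noncomputable section

set_option linter.dupNamespace false
set_option linter.unusedSectionVars false

open IsLocalRing
open Literature.AlgebraicGeometry.Resolution
open Summit.ResolutionOfSingularities.ResolutionOfSingularities.Theorems.RadicialJung.CleanModels

namespace Summit.ResolutionOfSingularities.ResolutionOfSingularities.Cruxes.DescentPerfectToAll.CpSibling.ArcPotentialProof

variable {K : Type} [Field K]

/-! ## Bricks (P0)–(P2) (verbatim from `Census_lens5_arcPotentialCore.lean` ad493c466fcd; crux workfiles do not import one another) -/

section Bricks

theorem exists_derivation_pow_mul (D : Derivation ℤ K K) {R : Subring K} (hD : ∀ y ∈ R, D y ∈ R)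
    {π : K} (hDπ : ∃ ε ∈ R, D π = π * ε) {F : K} (hF : F ∈ R) (a : ℕ) :
    ∃ Φ ∈ R, D (π ^ a * F) = π ^ a * Φ := by
  obtain ⟨ε, hε, hDπ⟩ := hDπ
  induction a with
  | zero => exact ⟨D F, hD F hF, by simp⟩
  | succ n ih =>
    obtain ⟨Φ, hΦ, hn⟩ := ih
    refine ⟨Φ + F * ε, R.add_mem hΦ (R.mul_mem hF hε), ?_⟩
    have h1 : π ^ (n + 1) * F = π * (π ^ n * F) := by ring
    rw [h1, Derivation.leibniz, smul_eq_mul, smul_eq_mul, hn, hDπ]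
    ring

/-- (P1) Jacobian bound. [folklore] -/
theorem jacobian_bound (D : Derivation ℤ K K) {R : Subring K} (hD : ∀ y ∈ R, D y ∈ R)
    {π : K} (hπR : π ∈ R) (hπ0 : π ≠ 0) (hDπ : ∃ ε ∈ R, D π = π * ε)
    {F u : K} (hF : F ∈ R) (hu : ∀ G ∈ R, u ≠ π * G) {a e : ℕ}
    (h : D (π ^ a * F) = π ^ e * u) : a ≤ e := by
  by_contra hle
  have hlt : e < a := not_le.mp hle
  obtain ⟨Φ, hΦ, hΦeq⟩ := exists_derivation_pow_mul D hD hDπ hF a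
  obtain ⟨d, hd⟩ := Nat.exists_eq_add_of_lt hlt
  apply hu (π ^ d * Φ) (R.mul_mem (R.pow_mem hπR d) hΦ)
  have h1 : π ^ e * u = π ^ e * (π * (π ^ d * Φ)) := by
    rw [← h, hΦeq, hd]; ring
  exact mul_left_cancel₀ (pow_ne_zero e hπ0) h1

theorem jacobian_bound_of_isUnit (D : Derivation ℤ K K) {R : Subring K} [IsLocalRing R] (hD : ∀ y ∈ R, D y ∈ R)
    {π : K} (hπR : π ∈ R) (hπ0 : π ≠ 0) (hπm : (⟨π, hπR⟩ : R) ∈ maximalIdeal R) (hDπ : ∃ ε ∈ R, D π = π * ε)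
    {F u : K} (hF : F ∈ R) (huR : u ∈ R) (hunit : IsUnit (⟨u, huR⟩ : R)) {a e : ℕ}
    (h : D (π ^ a * F) = π ^ e * u) : a ≤ e := by
  refine jacobian_bound D hD hπR hπ0 hDπ hF (fun G hG hG' => ?_) h
  have hmem : (⟨u, huR⟩ : R) ∈ maximalIdeal R := by
    have h1 : (⟨u, huR⟩ : R) = ⟨G, hG⟩ * ⟨π, hπR⟩ :=
      Subtype.ext (by change u = G * π; rw [hG', mul_comm])
    rw [h1]
    exact (maximalIdeal R).mul_mem_left _ hπm
  exact (IsLocalRing.mem_maximalIdeal _).mp hmem hunit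

variable {O : ValuationSubring K}

theorem valuation_le_sq_of_mem_sq' {R : Subring K} [IsLocalRing R] (hdom : SubringDominates R O.toSubring)
    {π : K} (hπ : ∀ x : K, O.valuation x < 1 → O.valuation x ≤ O.valuation π)
    (y : R) (hy : y ∈ maximalIdeal R ^ 2) : O.valuation (y : K) ≤ O.valuation π ^ 2 := by
  have hmem : ∀ a : R, a ∈ maximalIdeal R ↔ O.valuation (a : K) < 1 :=
    (subringDominates_valuationSubring_iff hdom.1).mp hdom
  rw [pow_two] at hy
  refine Submodule.mul_induction_on hy (fun a ha b hb => ?_) (fun a b ha hb => ?_)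
  · rw [Subring.coe_mul, map_mul, pow_two]
    exact mul_le_mul' (hπ _ ((hmem a).mp ha)) (hπ _ ((hmem b).mp hb))
  · rw [Subring.coe_add]
    exact Valuation.map_add_le _ ha hb

theorem valuation_lt_one_of_mul_le_sq {π x : K} (hπ0 : π ≠ 0) (hvπ1 : O.valuation π < 1)
    (hx : O.valuation (x * π) ≤ O.valuation π ^ 2) : O.valuation x < 1 := by
  have hvπ0 : 0 < O.valuation π := zero_lt_iff.mpr ((Valuation.ne_zero_iff _).mpr hπ0)
  rw [map_mul, pow_two, mul_comm] at hx
  exact lt_of_le_of_lt (le_of_mul_le_mul_left hx hvπ0) hvπ1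

theorem sub_mul_not_mem_sq {R : Subring K} [IsLocalRing R] (hdom : SubringDominates R O.toSubring)
    {π : K} (hπR : π ∈ R) (hπ0 : π ≠ 0) (hπm : (⟨π, hπR⟩ : R) ∈ maximalIdeal R)
    (hπ : ∀ x : K, O.valuation x < 1 → O.valuation x ≤ O.valuation π)
    (F : R) (hF2 : F ∉ maximalIdeal R ^ 2) (hvF : O.valuation (F : K) ≤ O.valuation π ^ 2) (l : R) :
    F - l * ⟨π, hπR⟩ ∉ maximalIdeal R ^ 2 := by
  have hmem : ∀ a : R, a ∈ maximalIdeal R ↔ O.valuation (a : K) < 1 :=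
    (subringDominates_valuationSubring_iff hdom.1).mp hdom
  intro hq
  have hvq := valuation_le_sq_of_mem_sq' hdom hπ _ hq
  have hvlπ : O.valuation ((l : K) * π) ≤ O.valuation π ^ 2 := by
    have h1 : (l : K) * π = (F : K) - ((F - l * ⟨π, hπR⟩ : R) : K) := by
      push_cast
      ring
    rw [h1]
    exact Valuation.map_sub_le _ hvF hvq
  have hvπ1 : O.valuation π < 1 := (hmem ⟨π, hπR⟩).mp hπm
  have hlm : l ∈ maximalIdeal R := (hmem l).mpr (valuation_lt_one_of_mul_le_sq hπ0 hvπ1 hvlπ)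
  apply hF2
  have h2 : F = (F - l * ⟨π, hπR⟩) + l * ⟨π, hπR⟩ := by ring
  rw [h2]
  exact (maximalIdeal R ^ 2).add_mem hq (by rw [pow_two]; exact Ideal.mul_mem_mul hlm hπm)

/-- (P2) independence of `π`, `F` modulo `𝔪²`. [folklore] -/
theorem indep_of_valuation {R : Subring K} [IsLocalRing R] (hdom : SubringDominates R O.toSubring)
    {π : K} (hπR : π ∈ R) (hπ0 : π ≠ 0) (hπm : (⟨π, hπR⟩ : R) ∈ maximalIdeal R)
    (hπ : ∀ x : K, O.valuation x < 1 → O.valuation x ≤ O.valuation π)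
    (F : R) (hFm : F ∈ maximalIdeal R) (hF2 : F ∉ maximalIdeal R ^ 2) (hvF : O.valuation (F : K) ≤ O.valuation π ^ 2)
    (a b : R) (hab : a * ⟨π, hπR⟩ + b * F ∈ maximalIdeal R ^ 2) : a ∈ maximalIdeal R ∧ b ∈ maximalIdeal R := by
  have hmem : ∀ a : R, a ∈ maximalIdeal R ↔ O.valuation (a : K) < 1 :=
    (subringDominates_valuationSubring_iff hdom.1).mp hdom
  have hb : b ∈ maximalIdeal R := by
    by_contra hbu
    have hbunit : IsUnit b := by
      rwa [IsLocalRing.mem_maximalIdeal, mem_nonunits_iff, not_not] at hbu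
    obtain ⟨w, hw⟩ := hbunit.exists_left_inv
    have h1 : F - (-(w * a)) * ⟨π, hπR⟩ ∈ maximalIdeal R ^ 2 := by
      have h2 : F - (-(w * a)) * ⟨π, hπR⟩ = w * (a * ⟨π, hπR⟩ + b * F) := by
        have h3 : w * (a * ⟨π, hπR⟩ + b * F) = w * a * ⟨π, hπR⟩ + (w * b) * F := by ring
        rw [h3, hw]; ring
      rw [h2]
      exact (maximalIdeal R ^ 2).mul_mem_left _ hab
    exact sub_mul_not_mem_sq hdom hπR hπ0 hπm hπ F hF2 hvF _ h1
  refine ⟨?_, hb⟩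
  have haπ : a * ⟨π, hπR⟩ ∈ maximalIdeal R ^ 2 := by
    have h1 : a * ⟨π, hπR⟩ = (a * ⟨π, hπR⟩ + b * F) - b * F := by ring
    rw [h1]
    exact (maximalIdeal R ^ 2).sub_mem hab (by rw [pow_two]; exact Ideal.mul_mem_mul hb hFm)
  have hv := valuation_le_sq_of_mem_sq' hdom hπ _ haπ
  rw [Subring.coe_mul] at hv
  have hvπ1 : O.valuation π < 1 := (hmem ⟨π, hπR⟩).mp hπm
  exact (hmem a).mpr (valuation_lt_one_of_mul_le_sq hπ0 hvπ1 hv)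

/-- (P0). [folklore] -/
theorem valuation_sub_pow_eq_pow_mul {p : ℕ} [Fact p.Prime] [CharP K p] (O : ValuationSubring K) (π : K) (hπ0 : π ≠ 0)
    (hvπ1 : O.valuation π < 1)
    (hπ : ∀ x : K, O.valuation x < 1 → O.valuation x ≤ O.valuation π)
    (harch : ∀ x : K, x ≠ 0 → ∃ n : ℕ, O.valuation π ^ n ≤ O.valuation x)
    (h : K) (hh : h ∈ O) (hnp : ∀ c : K, c ^ p ≠ h)
    (hdefect : ∀ c : K, ∃ c' : K, O.valuation (h - c' ^ p) < O.valuation (h - c ^ p))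
    (c : K) (hc : c ∈ O) : ∃ j : ℕ, O.valuation (h - c ^ p) = O.valuation π ^ (p * j) := by
  have hvπ0 : 0 < O.valuation π := zero_lt_iff.mpr ((Valuation.ne_zero_iff _).mpr hπ0)
  have hinj : Function.Injective (fun n : ℕ => O.valuation π ^ n) := (pow_right_strictAnti₀ hvπ0 hvπ1).injective
  have hf0 : h - c ^ p ≠ 0 := sub_ne_zero.mpr (Ne.symm (hnp c))
  have hfO : h - c ^ p ∈ O := O.sub_mem hh (O.pow_mem hc p)
  obtain ⟨n, hn⟩ :=
    Summit.ResolutionOfSingularities.ResolutionOfSingularities.Theorems.RadicialJung.CleanModels.exists_valuation_eq_pow_of_discrete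
      O π hπ harch (h - c ^ p) hf0 hfO
  by_cases hpn : p ∣ n
  · obtain ⟨j, rfl⟩ := hpn
    exact ⟨j, hn⟩
  exfalso
  obtain ⟨c', hc'⟩ := hdefect c
  -- `c' ∈ O`: otherwise `v(h − c'^p) = v(c'^p) > 1 ≥ v(h − c^p)`
  have hle1 : O.valuation (h - c ^ p) ≤ 1 := (O.valuation_le_one_iff _).mpr hfO
  have hc'O : c' ∈ O := by
    by_contra hc'O
    have hvc' : 1 < O.valuation c' := by
      rw [← not_le, O.valuation_le_one_iff]; exact hc'O
    have hvc'p : 1 < O.valuation (c' ^ p) := by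
      rw [map_pow]; exact one_lt_pow₀ hvc' (Fact.out : p.Prime).ne_zero
    have hvh : O.valuation h < O.valuation (c' ^ p) := lt_of_le_of_lt ((O.valuation_le_one_iff _).mpr hh) hvc'p
    have heq : O.valuation (h - c' ^ p) = O.valuation (c' ^ p) := Valuation.map_sub_eq_of_lt_right _ hvh
    have : O.valuation (h - c' ^ p) ≤ 1 := (hc'.le.trans hle1)
    rw [heq] at this
    exact absurd hvc'p (not_lt.mpr this)
  -- `d := c^p − c'^p = (h − c'^p) − (h − c^p)` has value `v(h − c^p) = v(π)^n`
  have hd : O.valuation (c ^ p - c' ^ p) = O.valuation π ^ n := by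
    have h1 : c ^ p - c' ^ p = (h - c' ^ p) - (h - c ^ p) := by ring
    rw [h1, Valuation.map_sub_eq_of_lt_right _ hc', hn]
  -- and is `(c − c')^p`
  have hd' : c ^ p - c' ^ p = (c - c') ^ p := (sub_pow_char c c').symm
  have hcc0 : c - c' ≠ 0 := by
    intro h0
    have : O.valuation (c ^ p - c' ^ p) = 0 := by rw [hd', h0, zero_pow (Fact.out : p.Prime).ne_zero, map_zero]
    rw [hd] at this
    exact (pow_ne_zero n hvπ0.ne') this
  obtain ⟨j, hj⟩ :=
    Summit.ResolutionOfSingularities.ResolutionOfSingularities.Theorems.RadicialJung.CleanModels.exists_valuation_eq_pow_of_discrete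
      O π hπ harch (c - c') hcc0 (O.sub_mem hc hc'O)
  have hpow : O.valuation π ^ n = O.valuation π ^ (p * j) := by
    rw [← hd, hd', map_pow, hj, ← pow_mul, mul_comm]
  exact hpn ⟨j, hinj hpow⟩

end Bricks


/-! ## Regular system of parameters bookkeeping in dimension 3 -/

section RSP

variable {S : Type*} [CommRing S] [IsLocalRing S]

/-- A regular local ring of dimension `3` has `𝔪 = (x₀, x₁, x₂)`. [folklore] -/
theorem exists_span_triple [IsNoetherianRing S] (hreg : IsRegularLocalRing S) (hdim : ringKrullDim S = 3) :
    ∃ x₀ x₁ x₂ : S, maximalIdeal S = Ideal.span {x₀, x₁, x₂} := by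
  haveI := hreg
  obtain ⟨x, hx⟩ := exists_regularSystemOfParameters (R := S)
  have hsf : (maximalIdeal S).spanFinrank = 3 := by
    have e := IsRegularLocalRing.spanFinrank_maximalIdeal (R := S)
    rw [hdim] at e; exact_mod_cast e
  let x' : Fin 3 → S := fun j => x (Fin.cast hsf.symm j)
  refine ⟨x' 0, x' 1, x' 2, ?_⟩
  rw [← hx]
  have hr : Set.range x = Set.range x' := by
    ext t
    simp only [Set.mem_range, x']
    constructor
    · rintro ⟨i, rfl⟩; exact ⟨Fin.cast hsf i, by simp⟩
    · rintro ⟨j, rfl⟩; exact ⟨Fin.cast hsf.symm j, rfl⟩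
  rw [hr]
  congr 1
  ext t
  simp only [Set.mem_range, Set.mem_insert_iff, Set.mem_singleton_iff]
  constructor
  · rintro ⟨i, rfl⟩; fin_cases i <;> simp
  · rintro (rfl | rfl | rfl)
    exacts [⟨0, rfl⟩, ⟨1, rfl⟩, ⟨2, rfl⟩]

/-- If `𝔪 = (x₀, x₁, x₂)`, `π ∈ 𝔪 ∖ 𝔪²`, `F ∈ 𝔪`, and `π`, `F` are independent modulo `𝔪²` (`a π + b F ∈ 𝔪² ⇒ b ∈ 𝔪`), then
`𝔪 = (π, F, t₃)` for some `t₃`. [folklore] -/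
theorem exists_span_triple_of_indep (x₀ x₁ x₂ π F : S)
    (hm : maximalIdeal S = Ideal.span {x₀, x₁, x₂}) (hπ : π ∈ maximalIdeal S) (hπ2 : π ∉ maximalIdeal S ^ 2)
    (hF : F ∈ maximalIdeal S) (hind : ∀ a b : S, a * π + b * F ∈ maximalIdeal S ^ 2 → b ∈ maximalIdeal S) :
    ∃ t₃ : S, maximalIdeal S = Ideal.span {π, F, t₃} := by
  obtain ⟨y, z, hy, hz, hmyz⟩ := exists_span_triple_of_not_mem_sq x₀ x₁ x₂ π hm hπ hπ2
  have hF' : F ∈ Ideal.span ({π, y, z} : Set S) := hmyz ▸ hF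
  obtain ⟨a₀, a₁, a₂, hFeq⟩ := (mem_span_triple_iff π y z F).mp hF'
  have perm : ∀ a b c : S, (Ideal.span {a, b, c} : Ideal S) = Ideal.span {b, a, c} := by
    intro a b c
    rw [Set.insert_comm]
  have perm' : ∀ a b c : S, (Ideal.span {a, b, c} : Ideal S) = Ideal.span {c, a, b} := by
    intro a b c
    congr 1
    ext t
    simp only [Set.mem_insert_iff, Set.mem_singleton_iff]
    tauto
  by_cases h₁ : IsUnit a₁
  · refine ⟨z, ?_⟩
    have e := span_triple_exchange y π z F a₁ a₀ a₂ (by rw [hmyz, perm]) (by rw [hFeq]; ring) h₁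
    rw [e, perm]
  by_cases h₂ : IsUnit a₂
  · refine ⟨y, ?_⟩
    have e := span_triple_exchange z π y F a₂ a₀ a₁ (by rw [hmyz, perm']) (by rw [hFeq]; ring) h₂
    rw [e, perm]
  exfalso
  have hm' : ∀ a : S, ¬ IsUnit a → a ∈ maximalIdeal S := fun a ha => (mem_maximalIdeal _).mpr (mem_nonunits_iff.mpr ha)
  have hsq : (-a₀) * π + 1 * F ∈ maximalIdeal S ^ 2 := by
    have e : (-a₀) * π + 1 * F = a₁ * y + a₂ * z := by rw [hFeq]; ring
    rw [e, pow_two]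
    exact Ideal.add_mem _ (Ideal.mul_mem_mul (hm' _ h₁) hy) (Ideal.mul_mem_mul (hm' _ h₂) hz)
  have h1 : (1 : S) ∈ maximalIdeal S := hind _ _ hsq
  exact (maximalIdeal.isMaximal S).ne_top ((Ideal.eq_top_iff_one _).mpr h1)

end RSP

/-! ## The core: the potential argument along the quadratic sequence -/

section Core

variable {O : ValuationSubring K} {p : ℕ}


/-- **Transport with factor `π`.**  Along the `π`-charts, if `s • D` preserves `R 0` then `π^N s • D` preserves `R N`. [folklore] -/
theorem derivation_transport_pow {O : ValuationSubring K} (R : ℕ → Subring K) [∀ i, IsLocalRing (R i)]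
    (h0 : SubringDominates (R 0) O.toSubring) (hstep : ∀ i, IsQuadraticTransformAlong O (R i) (R (i + 1)))
    (π : K) (hπR : π ∈ R 0) (hπ0 : π ≠ 0) (hvπ : O.valuation π < 1)
    (hπ : ∀ x : K, O.valuation x < 1 → O.valuation x ≤ O.valuation π)
    (D : Derivation ℤ K K) (s : K) (hD : ∀ y ∈ R 0, s * D y ∈ R 0) :
    ∀ N, ∀ y ∈ R N, π ^ N * s * D y ∈ R N := by
  intro N
  induction N with
  | zero => intro y hy; rw [pow_zero, one_mul]; exact hD y hy
  | succ N ih =>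
    obtain ⟨hπN, hRN⟩ := succ_eq_locAtCentre_blowupRing R h0 hstep π hπR hπ0 hvπ hπ N
    let E : Derivation ℤ K K := (π ^ N * s) • D
    have hE : ∀ y, E y = π ^ N * s * D y := fun y => by simp [E, smul_eq_mul]
    have hEN : ∀ y ∈ R N, E y ∈ R N := fun y hy => by rw [hE]; exact ih y hy
    have hB := mul_derivation_mem_blowupRing E hEN hπN hπ0
    have hL := mul_derivation_mem_locAtCentre E π (B := blowupRing (R N) π) (O := O) hB
    intro y hy
    rw [hRN] at hy
    have := hL y hy
    rw [hE] at this
    rw [hRN]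
    have e : π ^ (N + 1) * s * D y = π * (π ^ N * s * D y) := by ring
    rw [e]
    exact this

/-- The data of THEOREM P along the (restarted) quadratic sequence. -/
structure CoreHyp (O : ValuationSubring K) (p : ℕ) (R : ℕ → Subring K) (π : K) (D : Derivation ℤ K K) (s h u : K)
    (e₀ : ℕ) : Prop where
  reg : ∀ i, IsRegularLocalRing (R i)
  dim : ∀ i, ringKrullDim (R i) = 3
  dom0 : SubringDominates (R 0) O.toSubring
  step : ∀ i, IsQuadraticTransformAlong O (R i) (R (i + 1))
  πR : π ∈ R 0
  π0 : π ≠ 0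
  vπ : O.valuation π < 1
  πmax : ∀ x : K, O.valuation x < 1 → O.valuation x ≤ O.valuation π
  arch : ∀ x : K, x ≠ 0 → ∃ n : ℕ, O.valuation π ^ n ≤ O.valuation x
  der : ∀ y ∈ R 0, s * D y ∈ R 0
  hR : h ∈ R 0
  np : ∀ c : K, c ^ p ≠ h
  defect : ∀ c : K, ∃ c' : K, O.valuation (h - c' ^ p) < O.valuation (h - c ^ p)
  uR : u ∈ R 0
  vu : O.valuation u = 1
  Dh : s * D h = π ^ e₀ * u

/-- The three exits of the algorithm at stage `n` with current approximant `c`: loose clean forms (3), (2), (1). -/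
def CoreExit (R : ℕ → Subring K) [∀ i, IsLocalRing (R i)] (p : ℕ) (π h : K) (n : ℕ) (c : K) : Prop :=
  (∃ (m' : ℕ) (G : R n), G ∈ maximalIdeal (R n) ∧ G ∉ maximalIdeal (R n) ^ 2 ∧ (G : K) = (h - c ^ p) / π ^ (p * m')) ∨
  (∃ (m' : ℕ) (U : R n), IsUnit U ∧ (U : K) = (h - c ^ p) / π ^ (p * m') ∧
    ∀ c' : R n, U - c' ^ p ∉ maximalIdeal (R n)) ∨
  (∃ (m' r : ℕ) (hπn : π ∈ R n) (F t₃ : R n), 0 < r ∧ r < p ∧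
    maximalIdeal (R n) = Ideal.span {⟨π, hπn⟩, F, t₃} ∧ (h - c ^ p) / π ^ (p * m') = π ^ r * (F : K))

namespace CoreHyp

variable {R : ℕ → Subring K} [hRloc : ∀ i, IsLocalRing (R i)] {π : K} {D : Derivation ℤ K K} {s h u : K} {e₀ : ℕ}
  (H : CoreHyp O p R π D s h u e₀)
include H

theorem dom (i : ℕ) : SubringDominates (R i) O.toSubring := (sequence_dominates H.dom0 H.step i).1

theorem mono {i j : ℕ} (hij : i ≤ j) : R i ≤ R j := sequence_monotone H.step hij

theorem le_O (i : ℕ) : R i ≤ O.toSubring := (H.dom i).1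

theorem mem_max (i : ℕ) (a : R i) : a ∈ maximalIdeal (R i) ↔ O.valuation (a : K) < 1 :=
  (subringDominates_valuationSubring_iff (H.dom i).1).mp (H.dom i) a

theorem πRi (i : ℕ) : π ∈ R i := H.mono (Nat.zero_le i) H.πR

theorem πmem (i : ℕ) : (⟨π, H.πRi i⟩ : R i) ∈ maximalIdeal (R i) := (H.mem_max i _).mpr H.vπ

theorem πnot2 (i : ℕ) : (⟨π, H.πRi i⟩ : R i) ∉ maximalIdeal (R i) ^ 2 := by
  intro h2
  have hle := valuation_le_sq_of_mem_sq' (H.dom i) H.πmax _ h2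
  change O.valuation π ≤ O.valuation π ^ 2 at hle
  have hvπpos : 0 < O.valuation π := zero_lt_iff.mpr ((Valuation.ne_zero_iff _).mpr H.π0)
  rw [pow_two] at hle
  have : O.valuation π * 1 ≤ O.valuation π * O.valuation π := by rwa [mul_one]
  exact absurd (le_of_mul_le_mul_left this hvπpos) (not_le.mpr H.vπ)

theorem vπpos : 0 < O.valuation π := zero_lt_iff.mpr ((Valuation.ne_zero_iff _).mpr H.π0)

theorem pow_strictAnti : StrictAnti (fun n : ℕ => O.valuation π ^ n) := pow_right_strictAnti₀ H.vπpos H.vπ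

theorem pow_le_pow_iff {a b : ℕ} : O.valuation π ^ a ≤ O.valuation π ^ b ↔ b ≤ a :=
  StrictAnti.le_iff_ge H.pow_strictAnti

theorem pow_lt_pow_iff {a b : ℕ} : O.valuation π ^ a < O.valuation π ^ b ↔ b < a :=
  StrictAnti.lt_iff_gt H.pow_strictAnti

theorem pow_inj {a b : ℕ} (hab : O.valuation π ^ a = O.valuation π ^ b) : a = b :=
  StrictAnti.injective H.pow_strictAnti hab

theorem uRi (i : ℕ) : u ∈ R i := H.mono (Nat.zero_le i) H.uR

theorem u_unit (i : ℕ) : IsUnit (⟨u, H.uRi i⟩ : R i) := isUnit_of_valuation_eq_one R H.dom0 H.step i u (H.uRi i) H.vu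

/-- Stage transport of the derivation: `π^N s • D` preserves `R N`. [folklore] -/
theorem derN : ∀ N, ∀ y ∈ R N, π ^ N * s * D y ∈ R N :=
  derivation_transport_pow R H.dom0 H.step π H.πR H.π0 H.vπ H.πmax D s H.der

theorem derNπ {N : ℕ} (hN : 1 ≤ N) : ∃ ε ∈ R N, π ^ N * s * D π = π * ε := by
  obtain ⟨M, rfl⟩ := Nat.exists_eq_add_of_le hN
  refine ⟨π ^ M * (s * D π), (R (1 + M)).mul_mem ((R (1 + M)).pow_mem (H.πRi _) M) (H.mono (Nat.zero_le _) (H.der π H.πR)), ?_⟩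
  ring

theorem derNh (N : ℕ) : π ^ N * s * D h = π ^ (e₀ + N) * u := by
  rw [mul_assoc, H.Dh]; ring

omit hRloc H in
theorem derivation_pow_p [CharP K p] (D : Derivation ℤ K K) (c : K) : D (c ^ p) = 0 := by
  rw [Derivation.leibniz_pow, nsmul_eq_mul, CharP.cast_eq_zero K p, zero_mul]

variable [hp : Fact p.Prime] [CharP K p]

theorem f_ne (c : K) : h - c ^ p ≠ 0 := sub_ne_zero.mpr (Ne.symm (H.np c))

theorem hO : h ∈ O := H.le_O 0 H.hR

/-- (P1) at stage `N ≥ 1`: `(h − c^p)/π^a ∈ R N ⇒ a ≤ e₀ + N`. [folklore] -/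
theorem P1 {N : ℕ} (hN : 1 ≤ N) {c : K} {a : ℕ} (hF : (h - c ^ p) / π ^ a ∈ R N) : a ≤ e₀ + N := by
  let E : Derivation ℤ K K := (π ^ N * s) • D
  have hE : ∀ y, E y = π ^ N * s * D y := fun y => by simp [E, smul_eq_mul]
  have hEN : ∀ y ∈ R N, E y ∈ R N := fun y hy => by rw [hE]; exact H.derN N y hy
  have hEπ : ∃ ε ∈ R N, E π = π * ε := by
    obtain ⟨ε, hε, h1⟩ := H.derNπ hN
    exact ⟨ε, hε, by rw [hE, h1]⟩
  refine jacobian_bound_of_isUnit E hEN (H.πRi N) H.π0 (H.πmem N) hEπ hF (H.uRi N) (H.u_unit N) (a := a) (e := e₀ + N) ?_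
  have e1 : π ^ a * ((h - c ^ p) / π ^ a) = h - c ^ p := mul_div_cancel₀ _ (pow_ne_zero a H.π0)
  rw [e1, map_sub, derivation_pow_p, sub_zero, hE, H.derNh]

/-- `v(h − c^p) = v(π)^m` and `(h − c^p)/π^a ∈ R N` give `a ≤ m` and `v((h − c^p)/π^a) = v(π)^(m−a)`. -/
theorem exists_delta {N : ℕ} {c : K} {a m : ℕ} (hF : (h - c ^ p) / π ^ a ∈ R N)
    (hm : O.valuation (h - c ^ p) = O.valuation π ^ m) :
    ∃ δ : ℕ, m = a + δ ∧ O.valuation ((h - c ^ p) / π ^ a) = O.valuation π ^ δ := by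
  have hvπa : O.valuation π ^ a ≠ 0 := pow_ne_zero a H.vπpos.ne'
  have hvF : O.valuation ((h - c ^ p) / π ^ a) = O.valuation π ^ m / O.valuation π ^ a := by
    rw [map_div₀, map_pow, hm]
  have hle1 : O.valuation ((h - c ^ p) / π ^ a) ≤ 1 := (O.valuation_le_one_iff _).mpr (H.le_O N hF)
  have ham : a ≤ m := by
    rw [hvF, div_le_one₀ (zero_lt_iff.mpr hvπa)] at hle1
    exact H.pow_le_pow_iff.mp hle1
  obtain ⟨δ, rfl⟩ := Nat.exists_eq_add_of_le ham
  refine ⟨δ, rfl, ?_⟩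
  rw [hvF, pow_add, mul_div_cancel_left₀ _ hvπa]

theorem exists_ord (c : K) (hc : c ∈ O) : ∃ m : ℕ, O.valuation (h - c ^ p) = O.valuation π ^ m :=
  exists_valuation_eq_pow_of_discrete O π H.πmax H.arch (h - c ^ p) (H.f_ne c) (O.sub_mem H.hO (O.pow_mem hc p))

theorem p_dvd_ord {c : K} (hc : c ∈ O) {m : ℕ} (hm : O.valuation (h - c ^ p) = O.valuation π ^ m) : p ∣ m := by
  obtain ⟨j, hj⟩ := valuation_sub_pow_eq_pow_mul O π H.π0 H.vπ H.πmax H.arch h H.hO H.np H.defect c hc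
  rw [hm] at hj
  exact ⟨j, H.pow_inj hj⟩

/-- The bonus of the termination measure. -/
def bonus (δ : ℕ) : ℕ := if δ = 0 then 1 else if δ = 1 then 2 else 0

omit hRloc H hp in
theorem bonus_le (δ : ℕ) : bonus δ ≤ 2 := by
  unfold bonus; split_ifs <;> omega

/-- **The potential induction** (P3)–(P5): from any state `(N, c, a)` with `(h − c^p)/π^a ∈ R N` the algorithm reaches an exit. -/
theorem core_aux : ∀ (μ : ℕ) (N a m : ℕ) (c : K), c ∈ R N → (h - c ^ p) / π ^ a ∈ R N →
    O.valuation (h - c ^ p) = O.valuation π ^ m → 3 * (e₀ + N - a) + bonus (m - a) ≤ μ →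
    ∃ (n : ℕ) (c' : K), CoreExit R p π h n c' := by
  intro μ
  induction μ using Nat.strong_induction_on with
  | _ μ ih =>
  intro N a m c hcR hF hm hμ
  classical
  obtain ⟨δ, rfl, hvF⟩ := H.exists_delta hF hm
  rw [Nat.add_sub_cancel_left] at hμ
  set f : K := h - c ^ p with hfdef
  set F : K := f / π ^ a with hFdef
  have hfF : f = π ^ a * F := by rw [hFdef, mul_div_cancel₀ _ (pow_ne_zero a H.π0)]
  have hcO : c ∈ O := H.le_O N hcR
  let Fr : R N := ⟨F, hF⟩
  rcases Nat.lt_or_ge δ 1 with hδ | hδ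
  · -- δ = 0 : unit case (P3)
    have hδ0 : δ = 0 := by omega
    subst hδ0
    rw [pow_zero] at hvF
    have hunit : IsUnit Fr := isUnit_of_valuation_eq_one R H.dom0 H.step N F hF hvF
    obtain ⟨j, hj⟩ := H.p_dvd_ord hcO hm
    rw [Nat.add_zero] at hj
    by_cases hβ : ∃ β : R N, Fr - β ^ p ∈ maximalIdeal (R N)
    · -- update `c ↦ c + π^j β`
      obtain ⟨β, hβ⟩ := hβ
      set c' : K := c + π ^ j * (β : K) with hc'def
      have hc'R : c' ∈ R N := (R N).add_mem hcR ((R N).mul_mem ((R N).pow_mem (H.πRi N) j) β.2)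
      have hf' : h - c' ^ p = π ^ a * (F - (β : K) ^ p) := by
        rw [hc'def, add_pow_char, mul_pow, ← pow_mul, mul_comm j p, ← hj, mul_sub, ← hfF, hfdef]; ring
      have hF' : (h - c' ^ p) / π ^ a ∈ R N := by
        rw [hf', mul_div_cancel_left₀ _ (pow_ne_zero a H.π0)]
        exact (R N).sub_mem hF ((R N).pow_mem β.2 p)
      obtain ⟨m', hm'⟩ := H.exists_ord c' (H.le_O N hc'R)
      obtain ⟨δ', hδ'eq, hvF'⟩ := H.exists_delta hF' hm'
      -- `δ' ≥ 2`
      have hvlt : O.valuation ((h - c' ^ p) / π ^ a) < 1 := by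
        rw [hf', mul_div_cancel_left₀ _ (pow_ne_zero a H.π0)]
        exact (H.mem_max N (Fr - β ^ p)).mp hβ
      have hδ'pos : 0 < δ' := by
        rw [hvF'] at hvlt
        by_contra h0
        have : δ' = 0 := by omega
        rw [this, pow_zero] at hvlt
        exact lt_irrefl _ hvlt
      have hpd : p ∣ m' := H.p_dvd_ord (H.le_O N hc'R) hm'
      have hδ'2 : 2 ≤ δ' := by
        have hp2 : 2 ≤ p := hp.out.two_le
        obtain ⟨j', hj'⟩ := hpd
        have : p * j < p * j' := by rw [← hj, ← hj', hδ'eq]; omega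
        have hjj : j + 1 ≤ j' := Nat.lt_of_mul_lt_mul_left this
        have : a + δ' = p * j' := by rw [← hδ'eq, hj']
        nlinarith
      refine ih _ ?_ N a m' c' hc'R hF' hm' le_rfl
      rw [hδ'eq, Nat.add_sub_cancel_left]
      have hb : bonus δ' = 0 := by unfold bonus; rw [if_neg (by omega), if_neg (by omega)]
      have hb0 : bonus 0 = 1 := by unfold bonus; rw [if_pos rfl]
      rw [hb0] at hμ; rw [hb]; omega
    · -- EXIT, loose clean form (2)
      push Not at hβ
      refine ⟨N, c, Or.inr (Or.inl ⟨j, Fr, hunit, ?_, hβ⟩)⟩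
      change F = (h - c ^ p) / π ^ (p * j)
      rw [← hj]
  rcases Nat.lt_or_ge δ 2 with hδ2 | hδ2
  · -- δ = 1 : blow up (shape L2)
    have hδ1 : δ = 1 := by omega
    subst hδ1
    rw [pow_one] at hvF
    have hvF1 : O.valuation F < 1 := by rw [hvF]; exact H.vπ
    have hF' : F / π ∈ R (N + 1) := div_mem_succ_of_lt R H.dom0 H.step π H.πR H.π0 H.vπ H.πmax N F hF hvF1
    have hF'' : (h - c ^ p) / π ^ (a + 1) ∈ R (N + 1) := by
      have e : (h - c ^ p) / π ^ (a + 1) = F / π := by rw [hFdef, hfdef, pow_succ, div_div]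
      rw [e]; exact hF'
    refine ih _ ?_ (N + 1) (a + 1) (a + 1) c (H.mono (Nat.le_succ N) hcR) hF'' hm le_rfl
    have e1 : e₀ + (N + 1) - (a + 1) = e₀ + N - a := by omega
    rw [e1, Nat.sub_self]
    have hb0 : bonus 0 = 1 := by unfold bonus; rw [if_pos rfl]
    have hb1 : bonus 1 = 2 := by unfold bonus; rw [if_neg one_ne_zero, if_pos rfl]
    rw [hb1] at hμ; rw [hb0]; omega
  -- δ ≥ 2
  have hvF1 : O.valuation F < 1 := by
    rw [hvF]; exact pow_lt_one₀ zero_le H.vπ (by omega)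
  have hFm : Fr ∈ maximalIdeal (R N) := (H.mem_max N Fr).mpr hvF1
  have hbδ : bonus δ = 0 := by unfold bonus; rw [if_neg (by omega), if_neg (by omega)]
  rw [hbδ, Nat.add_zero] at hμ
  by_cases hF2 : Fr ∈ maximalIdeal (R N) ^ 2
  · -- blow up (shape L1): `a` rises by `2`
    have hF' : F / π ^ 2 ∈ R (N + 1) := div_pow_mem_succ_of_mem_pow R H.dom0 H.step π H.πR H.π0 H.vπ H.πmax N 2 Fr hF2
    have hF'' : (h - c ^ p) / π ^ (a + 2) ∈ R (N + 1) := by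
      have e : (h - c ^ p) / π ^ (a + 2) = F / π ^ 2 := by rw [hFdef, hfdef, pow_add, div_div]
      rw [e]; exact hF'
    have hP1 := H.P1 (Nat.le_add_left 1 N) hF''
    refine ih _ ?_ (N + 1) (a + 2) (a + δ) c (H.mono (Nat.le_succ N) hcR) hF'' hm le_rfl
    have hb := bonus_le (a + δ - (a + 2))
    omega
  · -- EXIT by the valuative detector (P2)
    have hvF2 : O.valuation (Fr : K) ≤ O.valuation π ^ 2 := by
      change O.valuation F ≤ _; rw [hvF]; exact H.pow_le_pow_iff.mpr hδ2
    have hind : ∀ a' b' : R N, a' * ⟨π, H.πRi N⟩ + b' * Fr ∈ maximalIdeal (R N) ^ 2 → b' ∈ maximalIdeal (R N) :=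
      fun a' b' hab => (indep_of_valuation (H.dom N) (H.πRi N) H.π0 (H.πmem N) H.πmax Fr hFm hF2 hvF2 a' b' hab).2
    haveI : IsRegularLocalRing (R N) := H.reg N
    obtain ⟨x₀, x₁, x₂, hx⟩ := exists_span_triple (H.reg N) (H.dim N)
    obtain ⟨t₃, ht₃⟩ := exists_span_triple_of_indep x₀ x₁ x₂ ⟨π, H.πRi N⟩ Fr hx (H.πmem N) (H.πnot2 N) hFm hind
    by_cases hpa : p ∣ a
    · -- loose clean form (3)
      obtain ⟨m', hm'⟩ := hpa
      refine ⟨N, c, Or.inl ⟨m', Fr, hFm, hF2, ?_⟩⟩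
      change F = (h - c ^ p) / π ^ (p * m')
      rw [← hm']
    · -- loose clean form (1) with exponents `(r, 1)`
      refine ⟨N, c, Or.inr (Or.inr ⟨a / p, a % p, H.πRi N, Fr, t₃, Nat.pos_of_ne_zero fun h0 => hpa
        (Nat.dvd_of_mod_eq_zero h0), Nat.mod_lt a hp.out.pos, ht₃, ?_⟩)⟩
      change (h - c ^ p) / π ^ (p * (a / p)) = π ^ (a % p) * F
      have hdm : a = p * (a / p) + a % p := (Nat.div_add_mod a p).symm
      rw [← hfdef, hfF]
      nth_rw 1 [hdm]
      rw [pow_add, mul_assoc, mul_div_cancel_left₀ _ (pow_ne_zero _ H.π0)]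

/-- **THEOREM P, core form.** [folklore] -/
theorem core : ∃ (n : ℕ) (c : K), CoreExit R p π h n c := by
  obtain ⟨m, hm⟩ := H.exists_ord 0 O.zero_mem
  refine H.core_aux _ 0 0 m 0 (R 0).zero_mem ?_ hm le_rfl
  rw [pow_zero, div_one, zero_pow hp.out.ne_zero, sub_zero]
  exact H.hR

end CoreHyp

end Core


/-! ## From the exits to the conclusion of the stub -/

section Conclusion

variable {k : Type} [Field k] [Algebra k K]

/-- The conclusion of `stub_cleanLU3Defect…` (verbatim copy of `Census_lens5_arcPotential.ArcConcl`). -/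
def ArcConcl (p : ℕ) (k K : Type) [Field k] [Field K] [Algebra k K] (O : ValuationSubring K) (A : Subalgebra k K)
    (g₀ : K) : Prop :=
  ∃ (A' : Subalgebra k K), A'.toSubring ≤ O.toSubring ∧ A ≤ A' ∧ A'.FG ∧
    ∃ (_ : IsRegularLocalRing (locAtCentre A'.toSubring O)) (c : Fin p → K), (∃ j : Fin p, (j : ℕ) ≠ 0 ∧ c j ≠ 0) ∧
    ((∃ (d m : ℕ) (hmd : m ≤ d) (t : Fin d → ↥(locAtCentre A'.toSubring O)) (a : Fin m → ℕ) (u : ↥(locAtCentre A'.toSubring O)), IsUnit u ∧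
    Ideal.span (Set.range t) = IsLocalRing.maximalIdeal ↥(locAtCentre A'.toSubring O) ∧
    ringKrullDim ↥(locAtCentre A'.toSubring O) = (d : WithBot ℕ∞) ∧ 0 < m ∧ (∀ i, ¬ p ∣ a i) ∧
    (∑ j : Fin p, c j ^ p * g₀ ^ (j : ℕ)) = (u : K) * ∏ i : Fin m, ((t (Fin.castLE hmd i) : ↥(locAtCentre A'.toSubring O)) : K) ^ (a i)) ∨
    (∃ u : ↥(locAtCentre A'.toSubring O), IsUnit u ∧ (∑ j : Fin p, c j ^ p * g₀ ^ (j : ℕ)) = (u : K) ∧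
    ∀ c' : ↥(locAtCentre A'.toSubring O), u - c' ^ p ∉ IsLocalRing.maximalIdeal ↥(locAtCentre A'.toSubring O)) ∨
    (∃ s c' : ↥(locAtCentre A'.toSubring O), (∑ j : Fin p, c j ^ p * g₀ ^ (j : ℕ)) = (s : K) ∧
    s - c' ^ p ∈ IsLocalRing.maximalIdeal ↥(locAtCentre A'.toSubring O) ∧
    s - c' ^ p ∉ IsLocalRing.maximalIdeal ↥(locAtCentre A'.toSubring O) ^ 2))

/-- Exit (3) ⇒ conclusion (this is ✓ `conclusion_of_core`). -/
theorem concl_of_exit3 {p : ℕ} [hp : Fact p.Prime] [CharP K p] {O : ValuationSubring K} {A A' : Subalgebra k K}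
    (hA'O : A'.toSubring ≤ O.toSubring) (hAA' : A ≤ A') (hA'fg : A'.FG)
    (Rn : Subring K) [IsLocalRing Rn] (hreg : IsRegularLocalRing Rn) (hRn : Rn = locAtCentre A'.toSubring O)
    (g₀ b c π : K) (hb : b ≠ 0) (hπ0 : π ≠ 0) (m' : ℕ)
    (G : Rn) (hGm : G ∈ maximalIdeal Rn) (hGm2 : G ∉ maximalIdeal Rn ^ 2) (hG : (G : K) = (b ^ p * g₀ - c ^ p) / π ^ (p * m')) :
    ArcConcl p k K O A g₀ :=
  conclusion_of_core hA'O hAA' hA'fg Rn hreg hRn g₀ b c π hb hπ0 m' G hGm hGm2 hG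

/-- Exit (2) ⇒ conclusion. [folklore] -/
theorem concl_of_exit2 {p : ℕ} [hp : Fact p.Prime] [CharP K p] {O : ValuationSubring K} {A A' : Subalgebra k K}
    (hA'O : A'.toSubring ≤ O.toSubring) (hAA' : A ≤ A') (hA'fg : A'.FG)
    (Rn : Subring K) [IsLocalRing Rn] (hreg : IsRegularLocalRing Rn) (hRn : Rn = locAtCentre A'.toSubring O)
    (g₀ b c π : K) (hb : b ≠ 0) (hπ0 : π ≠ 0) (m' : ℕ)
    (U : Rn) (hU : IsUnit U) (hUeq : (U : K) = (b ^ p * g₀ - c ^ p) / π ^ (p * m'))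
    (hres : ∀ c' : Rn, U - c' ^ p ∉ maximalIdeal Rn) :
    ArcConcl p k K O A g₀ := by
  subst hRn
  refine ⟨A', hA'O, hAA', hA'fg, hreg,
    fun j : Fin p => if (j : ℕ) = 0 then -c / π ^ m' else if (j : ℕ) = 1 then b / π ^ m' else 0, ?_, ?_⟩
  · refine ⟨⟨1, hp.out.one_lt⟩, one_ne_zero, ?_⟩
    simp only [one_ne_zero, if_false, if_true]
    exact div_ne_zero hb (pow_ne_zero _ hπ0)
  · refine Or.inr (Or.inl ⟨U, hU, ?_, hres⟩)
    rw [sum_rep_eq, hUeq]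

/-- Exit (1) ⇒ conclusion: the monomial `π^r F` with `(π, F, t₃)` a regular system of parameters, `0 < r < p`. [folklore] -/
theorem concl_of_exit1 {p : ℕ} [hp : Fact p.Prime] [CharP K p] {O : ValuationSubring K} {A A' : Subalgebra k K}
    (hA'O : A'.toSubring ≤ O.toSubring) (hAA' : A ≤ A') (hA'fg : A'.FG)
    (Rn : Subring K) [IsLocalRing Rn] (hreg : IsRegularLocalRing Rn) (hRn : Rn = locAtCentre A'.toSubring O)
    (hdimRn : ringKrullDim Rn = 3)
    (g₀ b c π : K) (hb : b ≠ 0) (hπ0 : π ≠ 0) (m' r : ℕ) (hr0 : 0 < r) (hrp : r < p)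
    (hπn : π ∈ Rn) (F t₃ : Rn) (hm : maximalIdeal Rn = Ideal.span {⟨π, hπn⟩, F, t₃})
    (heq : (b ^ p * g₀ - c ^ p) / π ^ (p * m') = π ^ r * (F : K)) :
    ArcConcl p k K O A g₀ := by
  subst hRn
  refine ⟨A', hA'O, hAA', hA'fg, hreg,
    fun j : Fin p => if (j : ℕ) = 0 then -c / π ^ m' else if (j : ℕ) = 1 then b / π ^ m' else 0, ?_, ?_⟩
  · refine ⟨⟨1, hp.out.one_lt⟩, one_ne_zero, ?_⟩
    simp only [one_ne_zero, if_false, if_true]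
    exact div_ne_zero hb (pow_ne_zero _ hπ0)
  · refine Or.inl ⟨3, 2, by norm_num, ![⟨π, hπn⟩, F, t₃], ![r, 1], 1, isUnit_one, ?_, ?_, by norm_num, ?_, ?_⟩
    · rw [hm]
      congr 1
      ext t
      simp only [Set.mem_range, Set.mem_insert_iff, Set.mem_singleton_iff]
      constructor
      · rintro ⟨i, rfl⟩
        fin_cases i <;> simp
      · rintro (rfl | rfl | rfl)
        · exact ⟨0, rfl⟩
        · exact ⟨1, rfl⟩
        · exact ⟨2, rfl⟩
    · rw [hdimRn]; rfl
    · intro i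
      fin_cases i
      · exact Nat.not_dvd_of_pos_of_lt hr0 hrp
      · exact hp.out.not_dvd_one
    · rw [sum_rep_eq, heq, Fin.prod_univ_two, Subring.coe_one, one_mul]
      change π ^ r * (F : K) = ((⟨π, hπn⟩ : ↥(locAtCentre A'.toSubring O)) : K) ^ r * (F : K) ^ 1
      rw [pow_one]

end Conclusion

/-! ## THEOREM P -/

section Main

variable {k : Type} [Field k] [Algebra k K]

/-- **THEOREM P** (memo e709ae1b8c5f §2): class (A) — discrete rank-one `O`, `g₀` with no best `p`-th-power approximation, a
derivation moving `g₀` with bounded denominators on `A` — has clean local uniformization in loose clean form, for EVERY residue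
tower and EVERY ground field.  (= ✓ `cleanLU3Defect_of_discrete_of_finiteResidue` without its finite-residue hypothesis; `htd`,
`hdimA` unused.) [folklore] -/
theorem arcPotential (p : ℕ) (hp : p.Prime) (k : Type) [Field k] [CharP k p] (K : Type) [Field K] [Algebra k K]
    (O : ValuationSubring K) (A : Subalgebra k K) (hAO : A.toSubring ≤ O.toSubring) (hAfg : A.FG)
    (hfrac : IsFractionRing A K) (_hdimA : ringKrullDim A ≤ 3) (hreg : IsRegularLocalRing (locAtCentre A.toSubring O))
    (hdim3 : ringKrullDim (locAtCentre A.toSubring O) = 3)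
    (hzd : ∀ (T : Subring K) (hT : T ≤ O.toSubring), A.toSubring ≤ T → (subringCentre T O hT).IsMaximal)
    (g₀ : K) (hg₀ : ∀ c : K, c ^ p ≠ g₀)
    (hdefect : ∀ f₀ : K, ∃ f₁ : K, O.valuation (g₀ - f₁ ^ p) < O.valuation (g₀ - f₀ ^ p))
    (_htd : ∀ hk : ∀ c : k, algebraMap k K c ∈ O, transcendenceDefect k O hk ≠ 0)
    (hdisc : ∃ π : K, π ≠ 0 ∧ (∀ x : K, O.valuation x < 1 → O.valuation x ≤ O.valuation π) ∧
      (∀ x : K, x ≠ 0 → ∃ n : ℕ, O.valuation π ^ n ≤ O.valuation x))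
    (hDer : ∃ (D : Derivation ℤ K K) (s : K), s ≠ 0 ∧ (∀ y : K, y ∈ A → s * D y ∈ A) ∧ D g₀ ≠ 0) :
    ArcConcl p k K O A g₀ := by
  obtain ⟨π, hπ0, hπ, harch⟩ := hdisc
  obtain ⟨D, s, hs0, hDA, hDg⟩ := hDer
  classical
  haveI : Fact p.Prime := ⟨hp⟩
  haveI : CharP K p := charP_of_injective_algebraMap (algebraMap k K).injective p
  -- (0) the quadratic sequence package
  have hd : ringKrullDim (locAtCentre A.toSubring O) ≠ 0 := by
    intro h0; rw [hdim3] at h0; exact absurd h0 (by decide)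
  obtain ⟨R, hR0, hstep, hregR, hdimR, hmodel⟩ := exists_quadraticSeq_package A O hAO hAfg hreg hd hzd
  haveI hRloc : ∀ i, IsLocalRing (R i) := fun i => by haveI := hregR i; infer_instance
  have h0dom : SubringDominates (R 0) O.toSubring := by rw [hR0]; exact subringDominates_locAtCentre hAO
  have hdom : ∀ i, SubringDominates (R i) O.toSubring := fun i => (sequence_dominates h0dom hstep i).1
  have hmono : ∀ {i j : ℕ}, i ≤ j → R i ≤ R j := fun hij => sequence_monotone hstep hij
  have hof : IsLocalRingOf (R 0) := by rw [hR0]; exact isLocalRingOf_locAtCentre A O hAO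
  have hdim3R : ∀ i, ringKrullDim (R i) = 3 := fun i => (hdimR i).trans hdim3
  have hAR0 : A.toSubring ≤ R 0 := by rw [hR0]; exact le_locAtCentre _ O
  have hmemR : ∀ i (a : R i), a ∈ maximalIdeal (R i) ↔ O.valuation (a : K) < 1 := fun i =>
    (subringDominates_valuationSubring_iff (hdom i).1).mp (hdom i)
  -- (1) `h = b^p g₀ ∈ A`
  obtain ⟨a, b, hb, hab⟩ := IsFractionRing.div_surjective (A := A) g₀
  have hab' : (a : K) / (b : K) = g₀ := hab
  have hb0 : (b : K) ≠ 0 := fun h => nonZeroDivisors.ne_zero hb (Subtype.ext h)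
  set h : K := (b : K) ^ p * g₀ with hhdef
  have hhA : h ∈ A := by
    have : h = (a : K) * (b : K) ^ (p - 1) := by
      obtain ⟨q, hq⟩ : ∃ q, p = q + 1 := ⟨p - 1, (Nat.sub_add_cancel hp.one_lt.le).symm⟩
      rw [hhdef, ← hab', hq, Nat.add_sub_cancel, pow_succ]
      field_simp
    rw [this]
    exact A.mul_mem a.2 (A.pow_mem b.2 _)
  -- `v π < 1`, `π ∈ O`
  have hne0 : maximalIdeal (R 0) ≠ ⊥ := by
    intro hbot
    have hfield : IsField (R 0) := IsLocalRing.isField_iff_maximalIdeal_eq.mpr hbot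
    have h0 : ringKrullDim (R 0) = 0 := ringKrullDim_eq_zero_of_isField hfield
    rw [hdim3R] at h0; exact absurd h0 (by decide)
  obtain ⟨m₀, hm₀m, hm₀0⟩ := Submodule.exists_mem_ne_zero_of_ne_bot hne0
  have hvπ : O.valuation π < 1 := by
    have hvm : O.valuation (m₀ : K) < 1 := (hmemR 0 m₀).mp hm₀m
    have hm0' : (m₀ : K) ≠ 0 := fun h0 => hm₀0 (Subtype.ext h0)
    obtain ⟨n, hn⟩ := harch _ hm0'
    by_contra hge
    push Not at hge
    have : (1 : O.ValueGroup) ≤ O.valuation π ^ n := one_le_pow₀ hge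
    exact absurd (this.trans hn) (not_le.mpr hvm)
  have hπO : π ∈ O := by rw [← O.valuation_le_one_iff]; exact hvπ.le
  have hvπpos : 0 < O.valuation π := zero_lt_iff.mpr ((Valuation.ne_zero_iff _).mpr hπ0)
  -- (2) transport of the derivation
  have hD0 : ∀ y ∈ R 0, s * D y ∈ R 0 := by
    rw [hR0]
    exact mul_derivation_mem_locAtCentre D s (B := A.toSubring) (O := O) (fun y hy => hDA y hy)
  have hDer := exists_derivation_preserving_seq R hstep D s hs0 hD0
  -- (3) climb until `π` is absorbed
  obtain ⟨n₁, hπn₁⟩ := exists_mem_of_quadraticTransforms_of_discrete O R hof h0dom hstep π hπ harch π hπO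
  -- the restarted sequence at `n₁`
  let R' : ℕ → Subring K := fun i => R (n₁ + i)
  haveI hR'loc : ∀ i, IsLocalRing (R' i) := fun i => hRloc (n₁ + i)
  have hstep' : ∀ i, IsQuadraticTransformAlong O (R' i) (R' (i + 1)) := fun i => by
    change IsQuadraticTransformAlong O (R (n₁ + i)) (R (n₁ + (i + 1)))
    rw [← add_assoc]; exact hstep (n₁ + i)
  have h0' : SubringDominates (R' 0) O.toSubring := hdom (n₁ + 0)
  have hπR' : π ∈ R' 0 := hπn₁
  -- the derivation at stage `n₁`, `E h = π^o u`
  obtain ⟨s₁, hs₁0, hD₁⟩ := hDer n₁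
  have hDh : D h = (b : K) ^ p * D g₀ := by
    rw [hhdef, Derivation.leibniz, Derivation.leibniz_pow]
    simp [smul_eq_mul, nsmul_eq_mul]
  have hEh0 : s₁ * D h ≠ 0 := mul_ne_zero hs₁0 (by rw [hDh]; exact mul_ne_zero (pow_ne_zero _ hb0) hDg)
  have hhR : h ∈ R n₁ := hmono (Nat.zero_le n₁) (hAR0 hhA)
  have hEhR : s₁ * D h ∈ R' 0 := hD₁ h hhR
  have hEhO : s₁ * D h ∈ O := (hdom n₁).1 hEhR
  obtain ⟨o, ho⟩ := exists_valuation_eq_pow_of_discrete O π hπ harch (s₁ * D h) hEh0 hEhO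
  obtain ⟨u, huR, hvu, hEu⟩ := exists_eq_pow_mul_unit R' h0' hstep' π hπR' hπ0 hvπ hπ o 0 (s₁ * D h) hEhR ho
  rw [Nat.zero_add] at huR
  -- restart again at `n₂ := n₁ + o`
  let R'' : ℕ → Subring K := fun i => R (n₁ + o + i)
  haveI hR''loc : ∀ i, IsLocalRing (R'' i) := fun i => hRloc (n₁ + o + i)
  have hstep'' : ∀ i, IsQuadraticTransformAlong O (R'' i) (R'' (i + 1)) := fun i => by
    change IsQuadraticTransformAlong O (R (n₁ + o + i)) (R (n₁ + o + (i + 1)))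
    rw [← add_assoc]; exact hstep (n₁ + o + i)
  have hder'' : ∀ y ∈ R'' 0, π ^ o * s₁ * D y ∈ R'' 0 :=
    derivation_transport_pow R' h0' hstep' π hπR' hπ0 hvπ hπ D s₁ hD₁ o
  have H : CoreHyp O p R'' π D (π ^ o * s₁) h u (o + o) :=
    { reg := fun i => hregR _
      dim := fun i => hdim3R _
      dom0 := hdom _
      step := hstep''
      πR := hmono (Nat.le_add_right n₁ o) hπn₁
      π0 := hπ0
      vπ := hvπ
      πmax := hπ
      arch := harch
      der := hder''
      hR := hmono (Nat.le_add_right n₁ o) hhR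
      np := by
        intro c hc
        apply hg₀ (c / (b : K))
        rw [div_pow, hc, hhdef, mul_div_cancel_left₀ _ (pow_ne_zero _ hb0)]
      defect := by
        intro c
        obtain ⟨f₁, hf₁⟩ := hdefect (c / (b : K))
        refine ⟨(b : K) * f₁, ?_⟩
        have e1 : h - ((b : K) * f₁) ^ p = (b : K) ^ p * (g₀ - f₁ ^ p) := by rw [hhdef]; ring
        have e2 : h - c ^ p = (b : K) ^ p * (g₀ - (c / (b : K)) ^ p) := by
          rw [hhdef, div_pow, mul_sub, mul_div_cancel₀ _ (pow_ne_zero _ hb0)]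
        rw [e1, e2, map_mul, map_mul]
        have hbp : 0 < O.valuation ((b : K) ^ p) :=
          zero_lt_iff.mpr ((Valuation.ne_zero_iff _).mpr (pow_ne_zero _ hb0))
        by_contra hle
        push Not at hle
        exact absurd (le_of_mul_le_mul_left hle hbp) (not_le.mpr hf₁)
      uR := huR
      vu := hvu
      Dh := by rw [mul_assoc, hEu]; ring }
  -- run the algorithm
  obtain ⟨n, c, hexit⟩ := H.core
  obtain ⟨A', hA'O, hAA', hA'fg, hRn⟩ := hmodel (n₁ + o + n)
  have hregn : IsRegularLocalRing (R'' n) := hregR _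
  rcases hexit with ⟨m', G, hGm, hGm2, hG⟩ | ⟨m', U, hU, hUeq, hres⟩ | ⟨m', r, hπn, F, t₃, hr0, hrp, hm, heq⟩
  · exact concl_of_exit3 hA'O hAA' hA'fg (R'' n) hregn hRn g₀ (b : K) c π hb0 hπ0 m' G hGm hGm2 (by rw [hG])
  · exact concl_of_exit2 hA'O hAA' hA'fg (R'' n) hregn hRn g₀ (b : K) c π hb0 hπ0 m' U hU (by rw [hUeq]) hres
  · exact concl_of_exit1 hA'O hAA' hA'fg (R'' n) hregn hRn (hdim3R _) g₀ (b : K) c π hb0 hπ0 m' r hr0 hrp hπn F t₃ hm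
      (by rw [← heq])

end Main


/-! ## The typed targets, closed -/

section Targets

/-- Verbatim copy of `Census_lens5_arcPotential.AbsDerivationMovesAt` (46f6cec37822); PROVED for prime `p` as
✓ `…CpSibling.AbsDerivation.absDerivationMovesAt_holds` (Cruxes workfile `Lens5_AbsDerivation.lean`, d237cf907357). -/
def AbsDerivationMovesAt (p : ℕ) : Prop :=
  ∀ (k : Type) [Field k] [CharP k p] (K : Type) [Field K] [Algebra k K] (A : Subalgebra k K), A.FG → IsFractionRing A K →
    ∀ g₀ : K, (∀ c : K, c ^ p ≠ g₀) →
    ∃ (D : Derivation ℤ K K) (s : K), s ≠ 0 ∧ (∀ y : K, y ∈ A → s * D y ∈ A) ∧ D g₀ ≠ 0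

/-- Verbatim copy of `Census_lens5_arcPotential.ArcPotentialAt` (46f6cec37822). -/
def ArcPotentialAt (p : ℕ) : Prop :=
  ∀ (k : Type) [Field k] [CharP k p] (K : Type) [Field K] [Algebra k K]
    (O : ValuationSubring K) (A : Subalgebra k K), A.toSubring ≤ O.toSubring → A.FG → IsFractionRing A K →
    ringKrullDim A ≤ 3 → IsRegularLocalRing (locAtCentre A.toSubring O) →
    ringKrullDim (locAtCentre A.toSubring O) = 3 →
    (∀ (T : Subring K) (hT : T ≤ O.toSubring), A.toSubring ≤ T → (subringCentre T O hT).IsMaximal) →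
    ∀ g₀ : K, (∀ c : K, c ^ p ≠ g₀) →
    (∀ f₀ : K, ∃ f₁ : K, O.valuation (g₀ - f₁ ^ p) < O.valuation (g₀ - f₀ ^ p)) →
    (∀ hk : ∀ c : k, algebraMap k K c ∈ O, transcendenceDefect k O hk ≠ 0) →
    (∃ π : K, π ≠ 0 ∧ (∀ x : K, O.valuation x < 1 → O.valuation x ≤ O.valuation π) ∧
      (∀ x : K, x ≠ 0 → ∃ n : ℕ, O.valuation π ^ n ≤ O.valuation x)) →
    (∃ (D : Derivation ℤ K K) (s : K), s ≠ 0 ∧ (∀ y : K, y ∈ A → s * D y ∈ A) ∧ D g₀ ≠ 0) →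
    ArcConcl p k K O A g₀

/-- **THEOREM P, typed target closed.** [folklore] -/
theorem arcPotentialAt_holds {p : ℕ} (hp : p.Prime) : ArcPotentialAt p := by
  intro k _ _ K _ _ O A hAO hAfg hfrac hdimA hreg hdim3 hzd g₀ hg₀ hdefect htd hdisc hDer
  exact arcPotential p hp k K O A hAO hAfg hfrac hdimA hreg hdim3 hzd g₀ hg₀ hdefect htd hdisc hDer

/-- **The lead's `stub_cleanLU3DefectArcInfinite` (CleanModels `Lines/Sketch.lean` rev 20, statement VERBATIM) from THEOREM P and
LEMMA D-abs.**  The only hypothesis `hD` is ✓ `absDerivationMovesAt_holds` of `Cruxes/DescentPerfectToAll/Lens5_AbsDerivation.lean`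
(d237cf907357, sorry-free; not importable from here because Cruxes modules are not built on the farm) — once both files are landed under
`Theorems/`, `cleanLU3DefectArcInfinite_of_absDerivation (fun p hp => absDerivationMovesAt_holds hp)` is the stub.  Note that the
infinite-residue-tower hypothesis (the last binder) is NOT used: THEOREM P is uniform in the residue tower. [folklore] -/
theorem cleanLU3DefectArcInfinite_of_absDerivation (hD : ∀ p : ℕ, p.Prime → AbsDerivationMovesAt p) :
    ∀ (p : ℕ), p.Prime →
    ∀ (k : Type) [Field k] [CharP k p] (K : Type) [Field K] [Algebra k K]
    (O : ValuationSubring K) (A : Subalgebra k K), A.toSubring ≤ O.toSubring → A.FG → IsFractionRing A K →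
    ringKrullDim A ≤ 3 → IsRegularLocalRing (locAtCentre A.toSubring O) →
    ringKrullDim (locAtCentre A.toSubring O) = 3 →
    (∀ (T : Subring K) (hT : T ≤ O.toSubring), A.toSubring ≤ T → (subringCentre T O hT).IsMaximal) →
    ∀ g₀ : K, (∀ c : K, c ^ p ≠ g₀) →
    (∀ f₀ : K, ∃ f₁ : K, O.valuation (g₀ - f₁ ^ p) < O.valuation (g₀ - f₀ ^ p)) →
    (∀ hk : ∀ c : k, algebraMap k K c ∈ O, transcendenceDefect k O hk ≠ 0) →
    (∃ π : K, π ≠ 0 ∧ (∀ x : K, O.valuation x < 1 → O.valuation x ≤ O.valuation π) ∧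
      (∀ x : K, x ≠ 0 → ∃ n : ℕ, O.valuation π ^ n ≤ O.valuation x)) →
    ¬ (∃ S : Finset K, (↑S : Set K) ⊆ O ∧
      ∀ y : K, y ∈ O → ∃ r : K, r ∈ Subring.closure ((locAtCentre A.toSubring O : Set K) ∪ ↑S) ∧ O.valuation (y - r) < 1) →
    ∃ (A' : Subalgebra k K), A'.toSubring ≤ O.toSubring ∧ A ≤ A' ∧ A'.FG ∧
    ∃ (_ : IsRegularLocalRing (locAtCentre A'.toSubring O)) (c : Fin p → K), (∃ j : Fin p, (j : ℕ) ≠ 0 ∧ c j ≠ 0) ∧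
    ((∃ (d m : ℕ) (hmd : m ≤ d) (t : Fin d → ↥(locAtCentre A'.toSubring O)) (a : Fin m → ℕ) (u : ↥(locAtCentre A'.toSubring O)), IsUnit u ∧
    Ideal.span (Set.range t) = IsLocalRing.maximalIdeal ↥(locAtCentre A'.toSubring O) ∧
    ringKrullDim ↥(locAtCentre A'.toSubring O) = (d : WithBot ℕ∞) ∧ 0 < m ∧ (∀ i, ¬ p ∣ a i) ∧
    (∑ j : Fin p, c j ^ p * g₀ ^ (j : ℕ)) = (u : K) * ∏ i : Fin m, ((t (Fin.castLE hmd i) : ↥(locAtCentre A'.toSubring O)) : K) ^ (a i)) ∨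
    (∃ u : ↥(locAtCentre A'.toSubring O), IsUnit u ∧ (∑ j : Fin p, c j ^ p * g₀ ^ (j : ℕ)) = (u : K) ∧
    ∀ c' : ↥(locAtCentre A'.toSubring O), u - c' ^ p ∉ IsLocalRing.maximalIdeal ↥(locAtCentre A'.toSubring O)) ∨
    (∃ s c' : ↥(locAtCentre A'.toSubring O), (∑ j : Fin p, c j ^ p * g₀ ^ (j : ℕ)) = (s : K) ∧
    s - c' ^ p ∈ IsLocalRing.maximalIdeal ↥(locAtCentre A'.toSubring O) ∧
    s - c' ^ p ∉ IsLocalRing.maximalIdeal ↥(locAtCentre A'.toSubring O) ^ 2)) := by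
  intro p hp k _ _ K _ _ O A hAO hAfg hfrac hdimA hreg hdim3 hzd g₀ hg₀ hdefect htd hdisc _
  exact arcPotential p hp k K O A hAO hAfg hfrac hdimA hreg hdim3 hzd g₀ hg₀ hdefect htd hdisc
    (hD p hp k K A hAfg hfrac g₀ hg₀)

/-- The same with the derivation as an explicit datum (no hypothesis on `p`-bases at all): the DISCRETE class (A) with ANY residue
tower, given a derivation moving `g₀` — e.g. the `k`-derivation of ✓ `derivation_of_not_mem_adjoin_pow` (5d37f7a70d6b) when
`g₀ ∉ k[K^p]`. [folklore] -/
theorem cleanLU3DefectArc_of_derivation :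
    ∀ (p : ℕ), p.Prime →
    ∀ (k : Type) [Field k] [CharP k p] (K : Type) [Field K] [Algebra k K]
    (O : ValuationSubring K) (A : Subalgebra k K), A.toSubring ≤ O.toSubring → A.FG → IsFractionRing A K →
    ringKrullDim A ≤ 3 → IsRegularLocalRing (locAtCentre A.toSubring O) →
    ringKrullDim (locAtCentre A.toSubring O) = 3 →
    (∀ (T : Subring K) (hT : T ≤ O.toSubring), A.toSubring ≤ T → (subringCentre T O hT).IsMaximal) →
    ∀ g₀ : K, (∀ c : K, c ^ p ≠ g₀) →
    (∀ f₀ : K, ∃ f₁ : K, O.valuation (g₀ - f₁ ^ p) < O.valuation (g₀ - f₀ ^ p)) →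
    (∀ hk : ∀ c : k, algebraMap k K c ∈ O, transcendenceDefect k O hk ≠ 0) →
    (∃ π : K, π ≠ 0 ∧ (∀ x : K, O.valuation x < 1 → O.valuation x ≤ O.valuation π) ∧
      (∀ x : K, x ≠ 0 → ∃ n : ℕ, O.valuation π ^ n ≤ O.valuation x)) →
    (∃ (D : Derivation ℤ K K) (s : K), s ≠ 0 ∧ (∀ y : K, y ∈ A → s * D y ∈ A) ∧ D g₀ ≠ 0) →
    ArcConcl p k K O A g₀ :=
  fun _ hp => arcPotentialAt_holds hp

end Targets

end Summit.ResolutionOfSingularities.ResolutionOfSingularities.Cruxes.DescentPerfectToAll.CpSibling.ArcPotentialProof
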